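import Literature.Barriers.RiemannHypothesis.EpsteinZetaRealZerosDHClassDensity
import Literature.Barriers.RiemannHypothesis.EpsteinZetaRealZerosDHConj
import HarnessLib

/-!
# Davenport–Heilbronn for Epstein zeta functions, IX: selecting split primes of a prescribed ideal
# class with prescribed mass `Σ 1/p`

Sibling of `Literature/Barriers/RiemannHypothesis/EpsteinZetaRealZeros.lean` (named fact
`DavenportHeilbronn1936b_epstein`). Everything in this file is PROVED; no definitions, no named facts.

Davenport–Heilbronn II, §4: "We denote by `𝔎₁, 𝔎₁⁻¹, …, 𝔎_N, 𝔎_N⁻¹` the ideal classes, other than the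
principal class, of the field `P(√d)` [`h(d) = 2N + 1` odd]. The two prime ideal factors of one of
our primes `p` lie in one pair `𝔎_j, 𝔎_j⁻¹` of these classes, and we divide the primes `p` into sets
`𝔏₁, …, 𝔏_N` […] the number of primes `p` in `𝔏_j` not exceeding `x` is asymptotically
`(1/h(d)) x/log x`". The construction of the auxiliary function `a(p)` in §5 then uses, of this,
only that each `𝔏_j` carries enough mass `Σ p^{-s}`. Here we supply the qualitative form of that
input which the tree affords (Dirichlet density `1/h` of every class,
`tendsto_primeSeries_primeClass_atTop`, from `L(1, χ) ≠ 0`):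

* `exists_ne_of_primeClass_ne_one` — for `h` odd, a prime `𝔭` of prime norm `p` in a non-principal
  class has a conjugate `𝔭' ≠ 𝔭` of norm `p` (`p` SPLITS; a lone prime of norm `p` would have
  `[𝔭]² = 1`, impossible in a group of odd order unless `[𝔭] = 1`);
* `exists_finset_sum_inv_ge` — the rational primes `p > Y` below the degree-one primes of a class
  `g` have unbounded `Σ 1/p`;
* `exists_finset_splitPrimes` — hence for `g ≠ 1`, `h` odd, every threshold `Y ≥ 1` and mass
  `μ ≥ 0` there is a finite set `F` of split primes `p > Y` whose prime factors lie in `g^{±1}`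
  with `μ ≤ Σ_{p∈F} 1/p ≤ μ + 1/Y` (a minimal such set);
* `exists_family_splitPrimes` — and finitely many such sets, for prescribed classes and masses,
  can be chosen pairwise disjoint.

## References

* [DavenportHeilbronn1936b] H. Davenport, H. Heilbronn, *On the zeros of certain Dirichlet
  series II*, J. London Math. Soc. 11 (1936), 307–312, §4.
-/

noncomputable section

open Filter Topology Complex NumberField IsDedekindDomain Module Finset
open Literature.NumberTheory.LFunctions Literature.NumberTheory.LFunctions.AbelianDensity
open scoped nonZeroDivisors Classical

namespace Literature.Barriers.RiemannHypothesis

namespace DHEpstein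

variable {K : Type*} [Field K] [NumberField K]

/-! ## Split primes of a class (odd class number) -/

/-- In a group of odd order, `g² = 1` forces `g = 1`. [folklore] -/
theorem eq_one_of_mul_self_eq_one_of_odd_card {G : Type*} [Group G] [Finite G]
    (hodd : Odd (Nat.card G)) {g : G} (h : g * g = 1) : g = 1 := by
  have h2 : orderOf g ∣ 2 := orderOf_dvd_of_pow_eq_one (by rw [pow_two]; exact h)
  have hc : orderOf g ∣ Nat.card G := orderOf_dvd_natCard g
  rcases (Nat.dvd_prime Nat.prime_two).1 h2 with h1 | h1
  · exact orderOf_eq_one_iff.1 h1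
  · exfalso
    rw [h1] at hc
    exact hodd.not_two_dvd_nat hc

/-- **For `h` odd, the degree-one primes of a non-principal class split** (D–H II §4: "The two
prime ideal factors of one of our primes `p` lie in one pair `𝔎_j, 𝔎_j⁻¹`"): if `[𝔭] ≠ 1` and
`N𝔭 = p` is prime, there is another prime `𝔭' ≠ 𝔭` of norm `p` (else `[𝔭]² = 1`,
`primeClass_mul_self_eq_one_of_forall_eq`, and `[𝔭] = 1` as `h` is odd).
[cite: DavenportHeilbronn1936b, §4] -/
theorem exists_ne_of_primeClass_ne_one (h2 : finrank ℚ K = 2) (hodd : Odd (Nat.card (ClassGroup (𝓞 K))))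
    {v : HeightOneSpectrum (𝓞 K)} (hg : primeClass v ≠ 1) {p : ℕ} (hp : p.Prime)
    (hv : Ideal.absNorm v.asIdeal = p) :
    ∃ w : HeightOneSpectrum (𝓞 K), w ≠ v ∧ Ideal.absNorm w.asIdeal = p := by
  by_contra hno
  push Not at hno
  have huniq : ∀ w : HeightOneSpectrum (𝓞 K), Ideal.absNorm w.asIdeal = p → w = v :=
    fun w hw ↦ by by_contra h; exact hno w h hw
  exact hg (eq_one_of_mul_self_eq_one_of_odd_card hodd
    (primeClass_mul_self_eq_one_of_forall_eq h2 hp hv huniq))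

/-- From a positive count of degree-one primes of class `g ≠ 1` above `p` (`h` odd): a split
prime `p = 𝔭𝔭'`, `𝔭 ≠ 𝔭'`, `[𝔭] = g`. [cite: DavenportHeilbronn1936b, §4] -/
theorem exists_pair_of_primeNormCount_pos (h2 : finrank ℚ K = 2) (hodd : Odd (Nat.card (ClassGroup (𝓞 K))))
    {g : ClassGroup (𝓞 K)} (hg : g ≠ 1) {p : ℕ} (hp : p.Prime)
    (hc : 1 ≤ primeNormCount K (frobFiber ⊤ (primeClass (K := K)) g) p) :
    ∃ v w : HeightOneSpectrum (𝓞 K), v ≠ w ∧ Ideal.absNorm v.asIdeal = p ∧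
      Ideal.absNorm w.asIdeal = p ∧ primeClass v = g := by
  unfold primeNormCount at hc
  obtain ⟨v, hv⟩ := Finset.card_pos.1 (Nat.lt_of_lt_of_le Nat.zero_lt_one hc)
  rw [Finset.mem_filter, mem_primesOfNorm, mem_frobFiber_primeClass] at hv
  obtain ⟨hN, hcls⟩ := hv
  obtain ⟨w, hwv, hw⟩ := exists_ne_of_primeClass_ne_one h2 hodd (hcls ▸ hg :  primeClass v ≠ 1) hp hN
  exact ⟨v, w, hwv.symm, hN, hw, hcls⟩

/-! ## Unbounded `Σ 1/p` over the primes of a class -/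

/-- **The primes below the degree-one primes of a class have divergent `Σ 1/p`**: for every class
`g`, threshold `Y` and bound `B` there is a finite set `F` of rational primes `p > Y`, each the
norm of a prime of class `g`, with `B ≤ Σ_{p∈F} 1/p`. (Otherwise `Σ 1/p` over these primes would
be summable, and `Σ_{[𝔭]=g, N𝔭=p} p^{-s} ≤ 2^{[K:ℚ]} (Σ_{p ≤ Y} 1 + Σ_{p>Y} 1/p)` would stay bounded
as `s → 1⁺`, against `tendsto_primeSeries_primeClass_atTop`.) [cite: DavenportHeilbronn1936b, §4] -/
theorem exists_finset_sum_inv_ge (g : ClassGroup (𝓞 K)) (Y : ℕ) (B : ℝ) :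
    ∃ F : Finset ℕ, (∀ p ∈ F, p.Prime ∧ Y < p ∧
      1 ≤ primeNormCount K (frobFiber ⊤ (primeClass (K := K)) g) p) ∧ B ≤ ∑ p ∈ F, (1 / p : ℝ) := by
  by_contra hcon
  push Not at hcon
  set X := frobFiber ⊤ (primeClass (K := K)) g with hX
  set cnt : ℕ → ℝ := fun p ↦ (primeNormCount K X p : ℝ) with hcnt
  set P : ℕ → Prop := fun p ↦ p.Prime ∧ Y < p ∧ 1 ≤ primeNormCount K X p with hP
  set f : ℕ → ℝ := fun p ↦ if P p then 1 / p else 0 with hf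
  have hf0 : ∀ p, 0 ≤ f p := fun p ↦ by
    simp only [hf]; split_ifs <;> positivity
  -- partial sums of `f` are `< B`
  have hpart : ∀ n, ∑ i ∈ Finset.range n, f i ≤ B := by
    intro n
    have h := hcon ((Finset.range n).filter P) (fun p hp ↦ (Finset.mem_filter.1 hp).2)
    rw [Finset.sum_filter] at h
    exact h.le
  have hfsum : Summable f := summable_of_sum_range_le hf0 hpart
  have htsum : ∑' p, f p ≤ B := Real.tsum_le_of_sum_range_le hf0 hpart
  -- the cut-off indicator
  set χY : ℕ → ℝ := fun p ↦ if p ≤ Y then 1 else 0 with hχY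
  have hχY0 : ∀ p, 0 ≤ χY p := fun p ↦ by simp only [hχY]; split_ifs <;> norm_num
  have hχYsupp : ∀ p ∉ Finset.range (Y + 1), χY p = 0 := fun p hp ↦ by
    simp only [Finset.mem_range, not_lt] at hp
    simp only [hχY]; rw [if_neg (by omega)]
  have hχYsum : Summable χY := summable_of_ne_finset_zero hχYsupp
  have hχYtsum : ∑' p, χY p ≤ Y + 1 := by
    rw [tsum_eq_sum hχYsupp]
    calc ∑ p ∈ Finset.range (Y + 1), χY p ≤ ∑ p ∈ Finset.range (Y + 1), (1 : ℝ) :=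
          Finset.sum_le_sum fun p _ ↦ by simp only [hχY]; split_ifs <;> norm_num
      _ = Y + 1 := by simp
  -- the bound on the prime series for `s > 1`
  set C : ℝ := (2 : ℝ) ^ finrank ℚ K with hC
  have hC0 : 0 ≤ C := by positivity
  have hcntC : ∀ q : Nat.Primes, cnt q ≤ C := fun q ↦ (le_abs_self _).trans (abs_primeNormCount_le X q)
  have hcnt0 : ∀ q : Nat.Primes, 0 ≤ cnt q := fun q ↦ Nat.cast_nonneg _
  have hbound : ∀ s : ℝ, 1 < s → primeSeries cnt s ≤ C * B + C * (Y + 1) := by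
    intro s hs
    rw [primeSeries_def]
    have hterm : ∀ q : Nat.Primes, cnt q * ((q : ℕ) : ℝ) ^ (-s) ≤ C * f q + C * χY q := by
      intro q
      have hq1 : (1 : ℝ) ≤ (q : ℕ) := by exact_mod_cast q.2.one_lt.le
      have hq0 : (0 : ℝ) < (q : ℕ) := by linarith
      have hrpow1 : ((q : ℕ) : ℝ) ^ (-s) ≤ 1 := Real.rpow_le_one_of_one_le_of_nonpos hq1 (by linarith)
      have hrpowq : ((q : ℕ) : ℝ) ^ (-s) ≤ 1 / (q : ℕ) := by
        rw [one_div, ← Real.rpow_neg_one]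
        exact Real.rpow_le_rpow_of_exponent_le hq1 (by linarith)
      have hrpow0 : 0 ≤ ((q : ℕ) : ℝ) ^ (-s) := Real.rpow_nonneg hq0.le _
      by_cases hc1 : 1 ≤ primeNormCount K X q
      · by_cases hYq : Y < q
        · have hPq : P q := ⟨q.2, hYq, hc1⟩
          have hfq : f q = 1 / (q : ℕ) := by simp only [hf, if_pos hPq]
          calc cnt q * ((q : ℕ) : ℝ) ^ (-s) ≤ C * (1 / (q : ℕ)) :=
                mul_le_mul (hcntC q) hrpowq hrpow0 hC0
            _ = C * f q + C * 0 := by rw [hfq]; ring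
            _ ≤ C * f q + C * χY q := by gcongr; exact hχY0 q
        · have hχ : χY q = 1 := by simp only [hχY]; rw [if_pos (not_lt.1 hYq)]
          calc cnt q * ((q : ℕ) : ℝ) ^ (-s) ≤ C * 1 := mul_le_mul (hcntC q) hrpow1 hrpow0 hC0
            _ = C * 0 + C * χY q := by rw [hχ]; ring
            _ ≤ C * f q + C * χY q := by gcongr; exact hf0 q
      · have h0 : primeNormCount K X q = 0 := by omega
        have : cnt q = 0 := by simp only [hcnt, h0, Nat.cast_zero]
        rw [this, zero_mul]
        have := hf0 q; have := hχY0 q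
        positivity
    have hsumL : Summable fun q : Nat.Primes ↦ cnt q * ((q : ℕ) : ℝ) ^ (-s) :=
      summable_primes_mul_rpow_of_bounded (fun q ↦ abs_primeNormCount_le X q) hs
    have hfP : Summable fun q : Nat.Primes ↦ f q := hfsum.subtype _
    have hχP : Summable fun q : Nat.Primes ↦ χY q := hχYsum.subtype _
    have hsumR : Summable fun q : Nat.Primes ↦ C * f q + C * χY q := (hfP.mul_left C).add (hχP.mul_left C)
    calc ∑' q : Nat.Primes, cnt q * ((q : ℕ) : ℝ) ^ (-s)
        ≤ ∑' q : Nat.Primes, (C * f q + C * χY q) := hsumL.tsum_le_tsum hterm hsumR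
      _ = C * ∑' q : Nat.Primes, f q + C * ∑' q : Nat.Primes, χY q := by
          rw [(hfP.mul_left C).tsum_add (hχP.mul_left C), tsum_mul_left, tsum_mul_left]
      _ ≤ C * B + C * (Y + 1) := by
          have h1 : ∑' q : Nat.Primes, f q ≤ ∑' p, f p := Summable.tsum_subtype_le f _ hf0 hfsum
          have h2 : ∑' q : Nat.Primes, χY q ≤ ∑' p, χY p := Summable.tsum_subtype_le χY _ hχY0 hχYsum
          gcongr
          · exact h1.trans htsum
          · exact h2.trans hχYtsum
  -- contradiction with the divergence at `1⁺`
  have hT := tendsto_primeSeries_primeClass_atTop (K := K) g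
  obtain ⟨s, hgt, hs1⟩ := ((hT.eventually_gt_atTop (C * B + C * (Y + 1))).and self_mem_nhdsWithin).exists
  exact absurd (hbound s hs1) (not_le.2 hgt)

/-! ## Selection with prescribed mass -/

/-- **Split primes of a prescribed class with prescribed mass.** Let `[K:ℚ] = 2`, `h_K` odd,
`g ≠ 1`, `Y ≥ 1`, `μ ≥ 0`. There is a finite set `F` of rational primes `p > Y`, each split,
`p = 𝔭𝔭'` with `𝔭 ≠ 𝔭'` and `[𝔭] = g`, such that `μ ≤ Σ_{p∈F} 1/p ≤ μ + 1/Y` (take a set of least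
cardinality with `Σ 1/p ≥ μ` among the subsets of a large enough finite set: removing any element
drops the sum below `μ`). [cite: DavenportHeilbronn1936b, §4] -/
theorem exists_finset_splitPrimes (h2 : finrank ℚ K = 2) (hodd : Odd (Nat.card (ClassGroup (𝓞 K))))
    {g : ClassGroup (𝓞 K)} (hg : g ≠ 1) {Y : ℕ} (hY : 1 ≤ Y) {μ : ℝ} (hμ : 0 ≤ μ) :
    ∃ F : Finset ℕ, (∀ p ∈ F, Y < p ∧ p.Prime ∧ ∃ v w : HeightOneSpectrum (𝓞 K), v ≠ w ∧
        Ideal.absNorm v.asIdeal = p ∧ Ideal.absNorm w.asIdeal = p ∧ primeClass v = g) ∧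
      μ ≤ ∑ p ∈ F, (1 / p : ℝ) ∧ ∑ p ∈ F, (1 / p : ℝ) ≤ μ + 1 / Y := by
  obtain ⟨F₀, hF₀, hge⟩ := exists_finset_sum_inv_ge (K := K) g Y μ
  have hex : ∃ k, ∃ F ⊆ F₀, F.card = k ∧ μ ≤ ∑ p ∈ F, (1 / p : ℝ) := ⟨F₀.card, F₀, subset_rfl, rfl, hge⟩
  obtain ⟨F, hFsub, hcard, hμF⟩ := Nat.find_spec hex
  have hmin : ∀ F' ⊆ F₀, F'.card < Nat.find hex → ¬ μ ≤ ∑ p ∈ F', (1 / p : ℝ) :=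
    fun F' hF' hlt hle ↦ Nat.find_min hex hlt ⟨F', hF', rfl, hle⟩
  refine ⟨F, fun p hp ↦ ?_, hμF, ?_⟩
  · obtain ⟨hpP, hYp, hc⟩ := hF₀ p (hFsub hp)
    exact ⟨hYp, hpP, exists_pair_of_primeNormCount_pos h2 hodd hg hpP hc⟩
  · by_cases hF : F = ∅
    · rw [hF, Finset.sum_empty] at hμF ⊢
      have : (0 : ℝ) ≤ 1 / Y := by positivity
      linarith
    · obtain ⟨p, hp⟩ := Finset.nonempty_iff_ne_empty.2 hF
      have hlt : ∑ q ∈ F.erase p, (1 / q : ℝ) < μ := by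
        have hcard' : (F.erase p).card < Nat.find hex := by
          rw [Finset.card_erase_of_mem hp, hcard]
          have : 0 < F.card := Finset.card_pos.2 ⟨p, hp⟩
          omega
        exact not_le.1 (hmin (F.erase p) ((F.erase_subset p).trans hFsub) hcard')
      rw [← Finset.sum_erase_add _ _ hp]
      have hYp : (Y : ℝ) < p := by exact_mod_cast (hF₀ p (hFsub hp)).2.1
      have hY0 : (0 : ℝ) < Y := by exact_mod_cast hY
      have h1p : (1 / p : ℝ) ≤ 1 / Y := one_div_le_one_div_of_le hY0 hYp.le
      linarith

/-- **Pairwise disjoint split-prime sets with prescribed classes and masses** (`[K:ℚ] = 2`, `h_K`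
odd): for finitely many indices `i` with classes `c i ≠ 1` and masses `m i ≥ 0`, and `Y ≥ 1`,
there are pairwise disjoint finite sets `S i` of split primes `p > Y` with prime factors in
`(c i)^{±1}` and `m i ≤ Σ_{p ∈ S i} 1/p ≤ m i + 1/Y` (choose them one after the other, each above
all primes already chosen). [cite: DavenportHeilbronn1936b, §4–§5] -/
theorem exists_family_splitPrimes (h2 : finrank ℚ K = 2) (hodd : Odd (Nat.card (ClassGroup (𝓞 K))))
    {ι : Type*} (s : Finset ι) (c : ι → ClassGroup (𝓞 K)) (m : ι → ℝ)
    (hc : ∀ i ∈ s, c i ≠ 1) (hm : ∀ i ∈ s, 0 ≤ m i) {Y : ℕ} (hY : 1 ≤ Y) :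
    ∃ S : ι → Finset ℕ,
      (∀ i ∈ s, (∀ p ∈ S i, Y < p ∧ p.Prime ∧ ∃ v w : HeightOneSpectrum (𝓞 K), v ≠ w ∧
          Ideal.absNorm v.asIdeal = p ∧ Ideal.absNorm w.asIdeal = p ∧ primeClass v = c i) ∧
        m i ≤ ∑ p ∈ S i, (1 / p : ℝ) ∧ ∑ p ∈ S i, (1 / p : ℝ) ≤ m i + 1 / Y) ∧
      ∀ i ∈ s, ∀ j ∈ s, i ≠ j → Disjoint (S i) (S j) := by
  induction s using Finset.induction_on with
  | empty => exact ⟨fun _ ↦ ∅, by simp, by simp⟩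
  | insert a s ha ih =>
    obtain ⟨S, hS, hdisj⟩ := ih (fun i hi ↦ hc i (Finset.mem_insert_of_mem hi))
      (fun i hi ↦ hm i (Finset.mem_insert_of_mem hi))
    -- threshold above everything chosen so far
    set Y' : ℕ := max Y ((s.biUnion S).sup id) with hY'
    have hY'1 : 1 ≤ Y' := le_max_of_le_left hY
    have hYY' : (Y : ℝ) ≤ Y' := by exact_mod_cast le_max_left _ _
    obtain ⟨F, hF, hμ, hle⟩ := exists_finset_splitPrimes h2 hodd (hc a (Finset.mem_insert_self a s))
      hY'1 (hm a (Finset.mem_insert_self a s))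
    have hFbig : ∀ p ∈ F, ∀ j ∈ s, p ∉ S j := by
      intro p hpF j hj hpS
      have h1 : Y' < p := (hF p hpF).1
      have h2' : p ≤ (s.biUnion S).sup id :=
        Finset.le_sup (f := id) (Finset.mem_biUnion.2 ⟨j, hj, hpS⟩)
      have h3 : (s.biUnion S).sup id ≤ Y' := le_max_right _ _
      omega
    refine ⟨Function.update S a F, ?_, ?_⟩
    · intro i hi
      rcases Finset.mem_insert.1 hi with rfl | hi
      · simp only [Function.update_self]
        refine ⟨fun p hp ↦ ?_, hμ, hle.trans ?_⟩
        · obtain ⟨hY'p, hpP, hex⟩ := hF p hp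
          exact ⟨lt_of_le_of_lt (le_max_left _ _) hY'p, hpP, hex⟩
        · have hY0 : (0 : ℝ) < Y := by exact_mod_cast hY
          linarith [one_div_le_one_div_of_le hY0 hYY']
      · have hia : i ≠ a := fun h ↦ ha (h ▸ hi)
        simp only [Function.update_of_ne hia]
        exact hS i hi
    · intro i hi j hj hij
      rcases Finset.mem_insert.1 hi with rfl | hi' <;> rcases Finset.mem_insert.1 hj with rfl | hj'
      · exact absurd rfl hij
      · have hja : j ≠ i := fun h ↦ ha (h ▸ hj')
        rw [Function.update_self, Function.update_of_ne hja]
        exact Finset.disjoint_left.2 fun p hpF hpS ↦ hFbig p hpF j hj' hpS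
      · have hia : i ≠ j := fun h ↦ ha (h ▸ hi')
        rw [Function.update_self, Function.update_of_ne hia]
        exact Finset.disjoint_right.2 fun p hpF hpS ↦ hFbig p hpF i hi' hpS
      · have hia : i ≠ a := fun h ↦ ha (h ▸ hi')
        have hja : j ≠ a := fun h ↦ ha (h ▸ hj')
        rw [Function.update_of_ne hia, Function.update_of_ne hja]
        exact hdisj i hi' j hj' hij

end DHEpstein

end Literature.Barriers.RiemannHypothesis
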